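import Summits.HubbardSuperconductivity.HubbardSuperconductivity.Theorems.BalabanIRBirComplexStableXYRThinFormBound
import Summits.HubbardSuperconductivity.HubbardSuperconductivity.Theorems.BalabanIRBirComplexStableXYRStubThinFormCoercive
import Summits.HubbardSuperconductivity.HubbardSuperconductivity.Theorems.BalabanIRBirComplexStableXYRStubThinFormPolar
import Literature.MathematicalPhysics.QuantumFieldTheory.TorusChartHodgeDecomposition
import HarnessLib

/-!
# Crux `BirComplexStableXYR` (stmt-HubbardSuperconductivity-14845), line `fat-gaussian-defect-calculus`, chapter 1
# (lead c7): the Coulomb-gas sandwich for the vortex strain energy `𝒬_c(σ_a)`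

Support file (prover seat 1, route BalabanIR; item G2 "Coulomb strain σ_a" of lead c7's 10:55Z list, part (b)).

In lead c7's exact Fröhlich–Spencer representation (`stub_fsRepresentation`) every tree-gauge vortex configuration `a`
carries the Gaussian weight `exp(−(K/2)·𝒬_c(σ_a))`, where `σ_a = 2πa − d₀ψ_a` is the strain left after the square
completion, characterised by the Pythagorean identity `𝒬_c(d₀u − σ_a) = 𝒬_c(d₀u) + 𝒬_c(σ_a)` for all `u`.  This file
bounds that energy from both sides, UNIFORMLY IN THE VOLUME, by the `ℓ²`-energy of the Coulomb (Hodge) representative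
`coexact (d₁ ω) + harm₁ ω` of the class `ω + d₀(·)` (`ω = 2πa`; Literature `TorusChartHodgeDecomposition`):

* `csw_thinForm_even` — `𝒬_c(−η) = 𝒬_c(η)` (polar form, `FSUnfolding.stub_thinFormPolar`);
* `csw_thinForm_le_of_pythagoras` — minimality: `𝒬_c(σ) ≤ 𝒬_c(ω − d₀ f)` for every `f` (Pythagoras + `𝒬_c ∘ d₀ ≥ 0`,
  `FSUnfolding.stub_thinFormCoercive`);
* **`coulombSandwich`** (registered stub of this seat on the crux item):
  `2c₀ · E(ω) ≤ 𝒬_c(σ) ≤ 6 r⁵ normA(c) · E(ω)`, `E(ω) := Σ_{x,i} (coexact (d₁ ω) + harm₁ ω)(x,i)²`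
  — lower: `stub_thinFormCoercive` and the `ℓ²`-minimality of the Coulomb representative
  (`TorusChart.sum_sq_coexact_add_harm₁_le`); upper: minimality of `σ` in `𝒬_c`, the Hodge decomposition
  `ω − d₀ (G δ₁ ω) = coexact (d₁ ω) + harm₁ ω` (`TorusChart.sub_d₀_green_δ₁`) and `thinForm_le_normSq`.

By `TorusChart.sum_sq_coexact_add_harm₁` and `TorusChart.sum_sq_coexact_d₁`,
`E(ω) = ½ Σ_{x,i,j} d₁ω · G d₁ω + Σ_{x,i} (harm₁ ω)²` is the Coulomb energy of the vortex current `d₁ ω` plus the flux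
(winding) energy; with `TorusChart.sum_d₁_sq_le`, `E(ω) ≥ ‖d₁ ω‖²/(16·3)`: the vortex sector of every admissible table is a
three-dimensional lattice Coulomb gas of closed currents up to the constants `2c₀` and `6r⁵ normA(c)`.

No definitions; sorry-free. [folklore]
-/

noncomputable section

namespace Summit.HubbardSuperconductivity.HubbardSuperconductivity.Theorems

set_option linter.dupNamespace false -- summit = problem name (single-conjunct summit), D-0017

open scoped BigOperators ComplexConjugate
open Complex Summit.HubbardSuperconductivity.BirComplexStableXYNegative
open Literature.Probability.LatticeModels Literature.MathematicalPhysics.QuantumFieldTheory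

section CoulombSandwich

variable {r : ℕ} {L M : ℕ} [NeZero L] [NeZero M]

/-- **The thin form is even**: `𝒬_c(−η) = 𝒬_c(η)` (it is the diagonal of a bilinear form, `stub_thinFormPolar`).
[folklore] -/
theorem csw_thinForm_even (c : Table r) (P : (Λ L M → Fin 3 → ℝ) → Λ L M → W r → ℝ)
    (hP : ∀ (ω : Λ L M → Fin 3 → ℝ) (s : Λ L M) (w : W r), P ω s w =
      (TorusChart.piProdZMod 2 L M).lineSum ω 0 (w.1 : ℕ) s
        + (TorusChart.piProdZMod 2 L M).lineSum ω 1 (w.2.1 : ℕ) (s + (w.1 : ℕ) • (TorusChart.piProdZMod 2 L M).gen 0)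
        + (TorusChart.piProdZMod 2 L M).lineSum ω 2 (w.2.2 : ℕ)
          (s + (w.1 : ℕ) • (TorusChart.piProdZMod 2 L M).gen 0 + (w.2.1 : ℕ) • (TorusChart.piProdZMod 2 L M).gen 1))
    (Q : (W r → ℝ) → ℝ) (hQ : ∀ u : W r → ℝ, Q u = (-c.sum (fun n a => a * (((∑ w, (n w : ℝ) * u w) ^ 2 : ℝ) : ℂ))).re)
    (η : Λ L M → Fin 3 → ℝ) : ∑ s : Λ L M, Q (P (-η) s) = ∑ s : Λ L M, Q (P η s) := by
  obtain ⟨B, _, hB⟩ := FSUnfolding.stub_thinFormPolar r c L M P hP Q hQ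
  rw [← hB, ← hB, map_neg, map_neg, LinearMap.neg_apply, neg_neg]

/-- **Minimality of the strain in the thin form**: if `σ = ω − d₀ψ` satisfies the Pythagorean identity
`𝒬_c(d₀u − σ) = 𝒬_c(d₀u) + 𝒬_c(σ)` for all `u` (the square completion of chapter 1) and `𝒬_c` is nonnegative on
gradients (here from `stub_thinFormCoercive`), then `𝒬_c(σ) ≤ 𝒬_c(ω − d₀f)` for every `f`. [folklore] -/
theorem csw_thinForm_le_of_pythagoras (c : Table r) {c₀ : ℝ} (hr : 2 ≤ r) (hc₀ : 0 < c₀)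
    (hA : c.sum (fun _ a => a) = 0)
    (hC : ∀ φ : W r → ℝ, c₀ * ∑ w, ∑ w', (1 - Real.cos (φ w - φ w')) ≤ (genF c φ).re)
    (P : (Λ L M → Fin 3 → ℝ) → Λ L M → W r → ℝ)
    (hP : ∀ (ω : Λ L M → Fin 3 → ℝ) (s : Λ L M) (w : W r), P ω s w =
      (TorusChart.piProdZMod 2 L M).lineSum ω 0 (w.1 : ℕ) s
        + (TorusChart.piProdZMod 2 L M).lineSum ω 1 (w.2.1 : ℕ) (s + (w.1 : ℕ) • (TorusChart.piProdZMod 2 L M).gen 0)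
        + (TorusChart.piProdZMod 2 L M).lineSum ω 2 (w.2.2 : ℕ)
          (s + (w.1 : ℕ) • (TorusChart.piProdZMod 2 L M).gen 0 + (w.2.1 : ℕ) • (TorusChart.piProdZMod 2 L M).gen 1))
    (Q : (W r → ℝ) → ℝ) (hQ : ∀ u : W r → ℝ, Q u = (-c.sum (fun n a => a * (((∑ w, (n w : ℝ) * u w) ^ 2 : ℝ) : ℂ))).re)
    (ω σ : Λ L M → Fin 3 → ℝ) (ψ : Λ L M → ℝ)
    (hσ : σ = fun x i => ω x i - (TorusChart.piProdZMod 2 L M).d₀ ψ x i)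
    (hpy : ∀ u : Λ L M → ℝ, ∑ s : Λ L M, Q (P (fun x i => (TorusChart.piProdZMod 2 L M).d₀ u x i - σ x i) s)
      = ∑ s : Λ L M, Q (P ((TorusChart.piProdZMod 2 L M).d₀ u) s) + ∑ s : Λ L M, Q (P σ s))
    (f : Λ L M → ℝ) :
    ∑ s : Λ L M, Q (P σ s) ≤ ∑ s : Λ L M, Q (P (fun x i => ω x i - (TorusChart.piProdZMod 2 L M).d₀ f x i) s) := by
  -- `ω − d₀ f = −(d₀ (f − ψ) − σ)`
  have hid : (fun x i => ω x i - (TorusChart.piProdZMod 2 L M).d₀ f x i)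
      = -(fun x i => (TorusChart.piProdZMod 2 L M).d₀ (f - ψ) x i - σ x i) := by
    funext x i
    simp only [hσ, Pi.neg_apply, TorusChart.d₀_sub, Pi.sub_apply]
    ring
  rw [hid, csw_thinForm_even c P hP Q hQ, hpy (f - ψ)]
  -- `𝒬_c (d₀ g) ≥ 2c₀ ‖d₀ g‖² ≥ 0`
  have hpos := FSUnfolding.stub_thinFormCoercive r c c₀ hr hc₀ hA hC L M ((TorusChart.piProdZMod 2 L M).d₀ (f - ψ))
  have hQP : ∀ s : Λ L M, Q (P ((TorusChart.piProdZMod 2 L M).d₀ (f - ψ)) s)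
      = (-c.sum (fun n a => a * (((∑ w : W r, (n w : ℝ) *
          ((TorusChart.piProdZMod 2 L M).lineSum ((TorusChart.piProdZMod 2 L M).d₀ (f - ψ)) 0 (w.1 : ℕ) s
            + (TorusChart.piProdZMod 2 L M).lineSum ((TorusChart.piProdZMod 2 L M).d₀ (f - ψ)) 1 (w.2.1 : ℕ)
                (s + (w.1 : ℕ) • (TorusChart.piProdZMod 2 L M).gen 0)
            + (TorusChart.piProdZMod 2 L M).lineSum ((TorusChart.piProdZMod 2 L M).d₀ (f - ψ)) 2 (w.2.2 : ℕ)
                (s + (w.1 : ℕ) • (TorusChart.piProdZMod 2 L M).gen 0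
                  + (w.2.1 : ℕ) • (TorusChart.piProdZMod 2 L M).gen 1))) ^ 2 : ℝ) : ℂ))).re := by
    intro s
    rw [hQ]
    simp only [hP]
  have hnn : 0 ≤ ∑ s : Λ L M, Q (P ((TorusChart.piProdZMod 2 L M).d₀ (f - ψ)) s) := by
    rw [Finset.sum_congr rfl fun s _ => hQP s]
    refine le_trans ?_ hpos
    exact mul_nonneg (mul_nonneg (by norm_num) hc₀.le)
      (Finset.sum_nonneg fun x _ => Finset.sum_nonneg fun i _ => sq_nonneg _)
  linarith

/-- **The Coulomb-gas sandwich for the strain energy** (registered stub `coulombSandwich` of prover seat 1 on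
stmt-HubbardSuperconductivity-14845; item G2(b) of lead c7's chapter 1).  For a table with (A) `Σ c_n = 0` and
coercivity (C) at range `r ≥ 2`, on every torus `Λ L M`, in lead c7's notation (`P` the staircase path map, `Q` the
real window Hessian): if a real `1`-cochain `σ = ω − d₀ψ` satisfies the square-completion identity
`Σ_s Q(P(d₀u − σ)) = Σ_s Q(P(d₀u)) + Σ_s Q(P σ)` for all `u` — as the strain `σ_a` of `stub_fsRepresentation` does
with `ω = 2πa` — then, with `E(ω) := Σ_{x,i} (coexact (d₁ ω) + harm₁ ω)(x,i)²` the `ℓ²`-energy of the Coulomb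
representative of the class of `ω` (`= ½⟨d₁ω, G d₁ω⟩ + ‖harm₁ ω‖²`, Coulomb energy of the vortex current plus flux
energy): `2c₀·E(ω) ≤ Σ_s Q(P σ) ≤ 6 r⁵ normA(c)·E(ω)`. [folklore] -/
theorem coulombSandwich : ∀ (r : ℕ) (c : Table r) (c₀ : ℝ), 2 ≤ r → 0 < c₀ → c.sum (fun _ a => a) = 0 → (∀ φ : W r → ℝ, c₀ * ∑ w, ∑ w', (1 - Real.cos (φ w - φ w')) ≤ (genF c φ).re) → ∀ (L M : ℕ) [NeZero L] [NeZero M] (P : (Λ L M → Fin 3 → ℝ) → Λ L M → W r → ℝ), (∀ (ω : Λ L M → Fin 3 → ℝ) (s : Λ L M) (w : W r), P ω s w = (Literature.MathematicalPhysics.QuantumFieldTheory.TorusChart.piProdZMod 2 L M).lineSum ω 0 (w.1 : ℕ) s + (Literature.MathematicalPhysics.QuantumFieldTheory.TorusChart.piProdZMod 2 L M).lineSum ω 1 (w.2.1 : ℕ) (s + (w.1 : ℕ) • (Literature.MathematicalPhysics.QuantumFieldTheory.TorusChart.piProdZMod 2 L M).gen 0) + (Literature.MathematicalPhysics.QuantumFieldTheory.TorusChart.piProdZMod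 2 L M).lineSum ω 2 (w.2.2 : ℕ) (s + (w.1 : ℕ) • (Literature.MathematicalPhysics.QuantumFieldTheory.TorusChart.piProdZMod 2 L M).gen 0 + (w.2.1 : ℕ) • (Literature.MathematicalPhysics.QuantumFieldTheory.TorusChart.piProdZMod 2 L M).gen 1)) → ∀ (Q : (W r → ℝ) → ℝ), (∀ u : W r → ℝ, Q u = (-c.sum (fun n a => a * (((∑ w, (n w : ℝ) * u w) ^ 2 : ℝ) : ℂ))).re) → ∀ (ω σ : Λ L M → Fin 3 → ℝ) (ψ : Λ L M → ℝ), (σ = fun x i => ω x i - (Literature.MathematicalPhysics.QuantumFieldTheory.TorusChart.piProdZMod 2 L M).d₀ ψ x i) → (∀ u : Λ L M → ℝ, ∑ s : Λ L M, Q (P (fun x i => (Literature.MathematicalPhysics.QuantumFieldTheory.TorusChart.piProdZMod 2 L M).d₀ u x i - σ x i) s) = ∑ s : Λ L M, Q (P ((Literature.MathematicalPhysics.QuantumFieldTheory.TorusChart.piProdZMod 2 L M).d₀ u) s) + ∑ s : Λ L M, Q (P σ s)) → 2 * c₀ * ∑ x : Λ L M, ∑ i : Fin 3, ((Literature.MathematicalPhysics.QuantumFieldTheory.TorusChart.piProdZMod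 2 L M).coexact ((Literature.MathematicalPhysics.QuantumFieldTheory.TorusChart.piProdZMod 2 L M).d₁ ω) x i + Literature.MathematicalPhysics.QuantumFieldTheory.TorusChart.harm₁ ω x i) ^ 2 ≤ ∑ s : Λ L M, Q (P σ s) ∧ ∑ s : Λ L M, Q (P σ s) ≤ 6 * (r : ℝ) ^ 5 * normA c * ∑ x : Λ L M, ∑ i : Fin 3, ((Literature.MathematicalPhysics.QuantumFieldTheory.TorusChart.piProdZMod 2 L M).coexact ((Literature.MathematicalPhysics.QuantumFieldTheory.TorusChart.piProdZMod 2 L M).d₁ ω) x i + Literature.MathematicalPhysics.QuantumFieldTheory.TorusChart.harm₁ ω x i) ^ 2 := by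
  intro r c c₀ hr hc₀ hA hC L M _ _ P hP Q hQ ω σ ψ hσ hpy
  set F := TorusChart.piProdZMod 2 L M with hF
  -- the thin form of an arbitrary cochain, unfolded
  have hQP : ∀ (η : Λ L M → Fin 3 → ℝ) (s : Λ L M), Q (P η s)
      = (-c.sum (fun n a => a * (((∑ w : W r, (n w : ℝ) *
          (F.lineSum η 0 (w.1 : ℕ) s + F.lineSum η 1 (w.2.1 : ℕ) (s + (w.1 : ℕ) • F.gen 0)
            + F.lineSum η 2 (w.2.2 : ℕ) (s + (w.1 : ℕ) • F.gen 0 + (w.2.1 : ℕ) • F.gen 1))) ^ 2 : ℝ) : ℂ))).re := by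
    intro η s
    rw [hQ]
    simp only [hP]
  constructor
  · -- lower bound: `2c₀ E ≤ 2c₀ ‖σ‖² ≤ 𝒬(σ)`
    have hcoer := FSUnfolding.stub_thinFormCoercive r c c₀ hr hc₀ hA hC L M σ
    rw [← Finset.sum_congr rfl fun s _ => hQP σ s] at hcoer
    have hmin := F.sum_sq_coexact_add_harm₁_le ω ψ
    have hσ2 : ∑ x : Λ L M, ∑ i : Fin 3, (ω x i - F.d₀ ψ x i) ^ 2 = ∑ x : Λ L M, ∑ i : Fin 3, (σ x i) ^ 2 := by
      simp only [hσ]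
    rw [hσ2] at hmin
    have h2c : 0 ≤ 2 * c₀ := by linarith
    exact le_trans (mul_le_mul_of_nonneg_left hmin h2c) hcoer
  · -- upper bound: `𝒬(σ) ≤ 𝒬(ω − d₀ (G δ₁ ω)) = 𝒬(coexact + harm) ≤ 6 r⁵ normA ‖coexact + harm‖²`
    have hle := csw_thinForm_le_of_pythagoras c hr hc₀ hA hC P hP Q hQ ω σ ψ hσ hpy (F.green (F.δ₁ ω))
    have hrep : (fun x i => ω x i - F.d₀ (F.green (F.δ₁ ω)) x i) = F.coexact (F.d₁ ω) + TorusChart.harm₁ ω := by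
      have := F.sub_d₀_green_δ₁ ω
      rw [← this]; rfl
    rw [hrep] at hle
    refine hle.trans ?_
    rw [Finset.sum_congr rfl fun s _ => hQP (F.coexact (F.d₁ ω) + TorusChart.harm₁ ω) s]
    have hub := thinForm_le_normSq r c L M (F.coexact (F.d₁ ω) + TorusChart.harm₁ ω)
    simpa only [Pi.add_apply] using hub

end CoulombSandwich

end Summit.HubbardSuperconductivity.HubbardSuperconductivity.Theorems

end
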